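import Mathlib
import HarnessLib
import Summits.ValiantsHypothesis.ValiantsHypothesis.Theses.MonotoneRestoration
import Literature.Computability.AlgebraicComplexity.ArithCircuit
import Literature.Computability.AlgebraicComplexity.ArithCircuitProofs
import Literature.Computability.AlgebraicComplexity.MonotoneStructure
import Literature.Computability.AlgebraicComplexity.PermanentIrreducible
import Literature.ModelTheory.FiniteModelTheory.CkEquiv
import Summits.ValiantsHypothesis.ValiantsHypothesis.Theorems.MonotoneRestorationMonotoneRestorationQPCosetCount
import Summits.ValiantsHypothesis.ValiantsHypothesis.Theorems.MonotoneRestorationMonotoneRestorationQPSymmetricLB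
import Summits.ValiantsHypothesis.ValiantsHypothesis.Theorems.MonotoneRestorationMonotoneRestorationQPSupportSymmetrisation
import Summits.ValiantsHypothesis.ValiantsHypothesis.Theorems.MonotoneRestorationMonotoneRestorationQPSparseRegime
import Summits.ValiantsHypothesis.ValiantsHypothesis.Theorems.MonotoneRestorationMonotoneRestorationQPBeta
import Literature.Computability.AlgebraicComplexity.SymmetricArithCircuit
import Literature.Computability.AlgebraicComplexity.DawarWilsenach2025Proofs
import Literature.GroupTheory.PermutationGroups.SmallIndexSubgroups
import Summits.ValiantsHypothesis.ValiantsHypothesis.Theorems.MonotoneRestorationQP.Negative.LoadBearing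
import Summits.ValiantsHypothesis.ValiantsHypothesis.Theorems.MonotoneRestorationMonotoneRestorationQPPermSupportCount

/-! TTRL-lite variant V19263 of stmt-ValiantsHypothesis-15886 -/

set_option linter.dupNamespace false

namespace Summit.ValiantsHypothesis.ValiantsHypothesis.Theorems

open Summit.ValiantsHypothesis.ValiantsHypothesis.Theses.MonotoneRestoration
open Literature.Computability.AlgebraicComplexity

/-- TTRL-lite variant V19263 (multiset form): substituting the row sums `∑ j, X (i, j)` into the
elementary symmetric polynomial `e_d` (via `bind₁`) gives `Multiset.esymm` of the multiset of
row sums. This is `MvPolynomial.aeval_esymm_eq_multiset_esymm` read through `bind₁ = aeval`. -/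
theorem stub_esymmRowSums_comp_var19263 :
    ∀ n d : ℕ, MvPolynomial.bind₁ (fun i : Fin n => ∑ j : Fin n, MvPolynomial.X (i, j))
      (MvPolynomial.esymm (Fin n) NNReal d) =
      (Multiset.map (fun i : Fin n => ∑ j : Fin n,
        (MvPolynomial.X (i, j) : MvPolynomial (Fin n × Fin n) NNReal))
        (Finset.univ : Finset (Fin n)).val).esymm d := by
  intro n d
  exact MvPolynomial.aeval_esymm_eq_multiset_esymm (σ := Fin n) (R := NNReal) d
    (fun i : Fin n => ∑ j : Fin n, (MvPolynomial.X (i, j) : MvPolynomial (Fin n × Fin n) NNReal))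

end Summit.ValiantsHypothesis.ValiantsHypothesis.Theorems
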